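import Summits.CriticalPhenomena.CardyFormulaZ2.Theorems.CardyIKTransportCornerLineDescentDiluteInfluenceReduction

/-!
# The four-quadrant support criterion for the single-defect influence (crux `CardyIKTransport.CornerLineDescent`)

Support file (`--supports stmt-CriticalPhenomena-10964`) for the registered stub `stub_DiluteInfluence` of the line
`symmetric-seed-second-order` (and equally for `stub_SummedInfluence`): a sharpening of the support bound of
`…DiluteInfluenceZeros` (`mem_splittingFaces_of_influence_ne_zero`, p85710).  The syndrome at the face `f` recolours
the lattice window `W` of the conformal rectangle by the quadrant of `f`; whenever ONE of the four quadrant classes of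
the window at `f` — `W ∩ (±farSide f₀) × (±farSide f₁)` — is empty, that recolouring coincides on `W` with a plaid
set (a half-plane, the empty set, or `[v₀ ∈ farSide f₀] ⊕ [v₁ ∉ farSide f₁]`), i.e. with a GAUGE SYMMETRY of the
five-factor measure (`influence_eq_zero_of_quadrant_iff`), so the signed influence `I_f(p)` vanishes EXACTLY, at every
density `p`.  Hence (`forall_quadrantClass_nonempty_of_influence_ne_zero`) a face of non-zero influence sees window
cells in all four classes; in particular for a CONVEX carrier every exterior face is silent, and for a general Jordan
carrier the exterior faces that can contribute to the Russo sums `influenceSum` are exactly the "exterior dislocations"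
sitting in boundary fjords (the worker's audit, lead c1 wave 1: law-level a boundary dislocation at the fjord wall).
References: route file `Theses/CardyIKTransport.lean` (item 10964); `Cruxes/CornerLineDescent/Disproof.lean` §G;
`Theorems/CardyIKTransportCornerLineDescentDiluteInfluenceZeros.lean`, `…DiluteInfluenceReduction.lean`.
-/

noncomputable section

namespace Summit.CriticalPhenomena.CardyFormulaZ2.Theorems.CornerLineDescent.SymmetricSeed

open scoped BigOperators Topology Classical MeasureTheory
open Filter Set Function MeasureTheory
open Literature.Probability.LatticeModels
open Literature.Probability.RandomPlanarGeometry

/-- If no window cell lies in the OPPOSITE quadrant class `(farSide f₀)ᶜ × (farSide f₁)ᶜ`, the quadrant of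
`f` is the plaid set `[v₀ ∈ farSide f₀] ⊕ [v₁ ∉ farSide f₁]` on the window, so `I_f(p) = 0`. [folklore] -/
theorem influence_eq_zero_of_forall_not_opposite (p : ℝ) (R : ConformalRectangle) (δ : ℝ) (f : Site 2)
    (h : ∀ v ∈ window R δ, v 0 ∈ farSide (f 0) ∨ v 1 ∈ farSide (f 1)) : influence p R δ f = 0 := by
  refine influence_eq_zero_of_quadrant_iff p R δ f (farSide (f 0)) (farSide (f 1))ᶜ fun v hv => ?_
  rw [mem_quadrant_iff, Set.mem_compl_iff]
  unfold Xor
  rcases h v hv with h0 | h1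
  · refine ⟨fun hq => Or.inl ⟨hq.1, not_not_intro hq.2⟩, ?_⟩
    rintro (⟨ha, hb⟩ | ⟨-, hna⟩)
    · exact ⟨ha, not_not.1 hb⟩
    · exact absurd h0 hna
  · refine ⟨fun hq => Or.inl ⟨hq.1, not_not_intro hq.2⟩, ?_⟩
    rintro (⟨ha, -⟩ | ⟨hnb, -⟩)
    · exact ⟨ha, h1⟩
    · exact absurd h1 hnb

/-- If no window cell lies in the class `(farSide f₀)ᶜ × farSide f₁`, the quadrant of `f` is the half-plane
`ℤ × farSide f₁` on the window, so `I_f(p) = 0`. [folklore] -/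
theorem influence_eq_zero_of_forall_not_left (p : ℝ) (R : ConformalRectangle) (δ : ℝ) (f : Site 2)
    (h : ∀ v ∈ window R δ, v 1 ∈ farSide (f 1) → v 0 ∈ farSide (f 0)) : influence p R δ f = 0 := by
  refine influence_eq_zero_of_quadrant_iff p R δ f ∅ (farSide (f 1)) fun v hv => ?_
  rw [mem_quadrant_iff, Set.mem_empty_iff_false, xor_false, id_eq]
  exact ⟨fun h' => h'.2, fun h' => ⟨h v hv h', h'⟩⟩

/-- If no window cell lies in the class `farSide f₀ × (farSide f₁)ᶜ`, the quadrant of `f` is the half-plane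
`farSide f₀ × ℤ` on the window, so `I_f(p) = 0`. [folklore] -/
theorem influence_eq_zero_of_forall_not_below (p : ℝ) (R : ConformalRectangle) (δ : ℝ) (f : Site 2)
    (h : ∀ v ∈ window R δ, v 0 ∈ farSide (f 0) → v 1 ∈ farSide (f 1)) : influence p R δ f = 0 := by
  refine influence_eq_zero_of_quadrant_iff p R δ f (farSide (f 0)) ∅ fun v hv => ?_
  rw [mem_quadrant_iff, Set.mem_empty_iff_false]
  unfold Xor
  have := h v hv
  tauto

/-- THE FOUR-QUADRANT CRITERION: a face with non-zero influence sees window cells in ALL FOUR quadrant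
classes at `f`. [folklore] -/
theorem forall_quadrantClass_nonempty_of_influence_ne_zero :
    ∀ {p : ℝ} {R : ConformalRectangle} {δ : ℝ} {f : Site 2}, influence p R δ f ≠ 0 →
      (∃ v ∈ window R δ, v 0 ∈ farSide (f 0) ∧ v 1 ∈ farSide (f 1)) ∧
      (∃ v ∈ window R δ, v 0 ∉ farSide (f 0) ∧ v 1 ∈ farSide (f 1)) ∧
      (∃ v ∈ window R δ, v 0 ∈ farSide (f 0) ∧ v 1 ∉ farSide (f 1)) ∧
      (∃ v ∈ window R δ, v 0 ∉ farSide (f 0) ∧ v 1 ∉ farSide (f 1)) := by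
  intro p R δ f h
  refine ⟨?_, ?_, ?_, ?_⟩ <;> by_contra hc <;> push Not at hc <;> apply h
  · exact influence_eq_zero_of_forall_notMem_quadrant p fun v hv hq =>
      hc v hv ((mem_quadrant_iff f v).1 hq).1 ((mem_quadrant_iff f v).1 hq).2
  · exact influence_eq_zero_of_forall_not_left p R δ f fun v hv h1 => by
      by_contra h0; exact hc v hv h0 h1
  · exact influence_eq_zero_of_forall_not_below p R δ f hc
  · exact influence_eq_zero_of_forall_not_opposite p R δ f fun v hv => by
      by_cases h0 : v 0 ∈ farSide (f 0)
      · exact Or.inl h0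
      · exact Or.inr (hc v hv h0)

end Summit.CriticalPhenomena.CardyFormulaZ2.Theorems.CornerLineDescent.SymmetricSeed
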